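import Summits.Ventures.CertifiedManyBodySolver.Observables.MeanFieldClassExclusionObjectE
import Literature.MathematicalPhysics.QuantumLattice.HubbardFermiSeaTangentRowsLow
import HarnessLib

/-!
# Ventures/CertifiedManyBodySolver — Observables/MeanFieldClassExclusionObjectE2.lean

HONEST FRAMING: first certified bounds; not a superconductivity verdict; every number certified or labelled float.
A competing-order EXCLUSION removes a named class of candidate ground states; it never says which order is present;
no phase sentence follows.

Cell `hubbard-tc` (MO-S3, D-0096), seat `hubbard-tc-mod-3` (G3), `prover-hubbard-tc-mod-3-g4-0`. Continuation of
`MeanFieldClassExclusionObjectE.lean` (same devices, same grammar) for the two DOPING COLUMNS OF RECORD added by S1 on 2026-08-27: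

* `ccocE_x020_docc_lt_of` — Ca₁.₈Na₀.₂CuO₂Cl₂ (VSET-v2 M57), object E `U/t_eff ∈ [6.4, 12.9]`, `t′/t_eff ∈ [−0.38, −0.27]`, `n ∈ [0.78, 0.82]`
  (`pub/hubbard-downfold/router/BOXES/CCOC-Na010.md` §OF-RECORD v1.3/v1.4, x = 0.20 column): MF/BCS class excluded on the WHOLE box —
  for `t′ ∈ [−2/5, −1/4]`, `n ∈ [39/50, 41/50]`, EVERY `U ≥ 32/5`; cond. #445 ∧ #473 (the `t′`-chord cap `objE_conc78_cap8` carried down by the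
  vacuum chord `objE_lowBand_cap8`; floors = tangent Fermi-sea rows read between the columns `−2/5` (touch `21/25`), `−3/10`, `−1/4` (touch `39/50`)
  by concavity); smallest exact linear margin `+0.032` (at `U₁ = 6.4`, `t′ = −2/5`, `n = 0.78`).
* `ndE_x010_docc_lt_of` — Nd₀.₉Sr₀.₁NiO₂ (VSET-v2 M59), object E `[5.0, 8.5] × [−0.46, −0.36] × [0.79, 0.89]` (`BOXES/NdNiO2.md` §OF-RECORD v1.4–v1.7):
  MF/BCS class excluded on the sub-box `U ≥ 67/10` — `t′ ∈ [−23/50, −9/25]`, `n ∈ [79/100, 89/100]`, EVERY `U ≥ 6.7`; cond. #445 ∧ #473 ∧ #472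
  (band split at `7/8`: vacuum chord below, density chord to the half-filling cap #472 above; floors = tangent rows at `21/25` below / `7/8` above on
  the columns `−1/2, −2/5, −3/10`); smallest margin `+0.033`. The strip `[5.0, 6.7)` of that box carries NO word (the same open low-`U` corner as
  M21 `[5.0, 5.8)` and M22 `[5.0, 6.5)`: at `|t′/t_eff| ≈ 0.4` the only caps of record are the `U = 8` rows, and the free-gas gap closes as `U` drops).

For every torus limit `ω` of unit `(rectN n L, S^z = 0)`-sector ground states of `hubbardTorusTT' L 1 t′ U` the words conclude
`Re ω(n_{0↑} n_{0↓}) < (n/2)²` (no Hartree–Fock / singlet-BCS ground state — Wick). Exact designer: `hubbard-tc-mod-3/g4-replay/deep_design.py`.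
WHAT THIS IS NOT: a statement about stripes, d-wave order or T_c; the saturated-FM class (not excluded on these boxes); tight; a phase word.

References: T. Koma, H. Tasaki, J. Stat. Phys. 76 (1994) 745, §1 [KomaTasaki1994]; V. Bach, E. H. Lieb, J. P. Solovej,
J. Stat. Phys. 76 (1994) 3, eq. (2c.36) [BachLiebSolovej1994]; E. H. Lieb, M. Loss, Duke Math. J. 71 (1993) 337, §8 Thm 8.2
[LiebLoss1993]; R. B. Israel, Convexity in the Theory of Lattice Gases (1979), Thm I.3.4 [Israel1979]; D. Ruelle,
Statistical Mechanics (1969) §3.3 [Ruelle1969].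
-/

noncomputable section

namespace Summit.Ventures.CertifiedManyBodySolver.Observables

open Literature.MathematicalPhysics.QuantumLattice
open Literature.MathematicalPhysics.QuantumLattice.ThermodynamicLimit
open Summit.Ventures.CertifiedManyBodySolver.Certificates
open Matrix HubbardWave0 Literature.Probability.LatticeModels Filter Topology
open scoped ComplexOrder BigOperators

/-- **Ca₁.₈Na₀.₂CuO₂Cl₂ (VSET-v2 M57), OBJECT E `[6.4, 12.9] × [−0.38, −0.27] × [0.78, 0.82]` — MF/BCS class excluded on the WHOLE box.**
Assume the claim nodes of CERTIFIED #445 and #473. For every `t′ ∈ [−2/5, −1/4]`, EVERY `U ≥ 32/5` and `n ∈ [39/50, 41/50]`, every GS torus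
limit has `Re ω(n_{0↑}n_{0↓}) < (n/2)²`. Cap at `U = 8` = the `t′`-chord of #445 over the #473 floor (`objE_conc78_cap8`, `t′ ≤ −1/4`) carried to
the band by the vacuum chord (`objE_lowBand_cap8`, bilinear term linearised at `n = 41/50`); floor = tangent rows on the columns `−2/5` (touch `21/25`),
`−3/10`, `−1/4` (touch `39/50`) read between columns by concavity; `U ≠ 8` by `doccN_lt_of_cap8_threshold`; smallest margin `+0.032`.
[cite: KomaTasaki1994, §1] [cite: BachLiebSolovej1994, eq. (2c.36)] [cite: LiebLoss1993, §8, Theorem 8.2] -/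
theorem ccocE_x020_docc_lt_of (h445 : cert_dbt329pair_allk)
    (h473 : cert_r473_bs_M3U8tp0_w3_b4_R2_ob5p2_kry1_kry2c3rel_hanK7B4D4_KN4_PR20d4_hanK8c2s_hanK8B4D4_uprime)
    {t' U n : ℝ} (ht1 : -2 / 5 ≤ t') (ht2 : t' ≤ -1 / 4) (hU : 32 / 5 ≤ U)
    (hn1 : 39 / 50 ≤ n) (hn2 : n ≤ 41 / 50) :
    ∀ (ω : InfVolFermionState 2) (Ls : ℕ → ℕ) (ψ : ∀ L, Fock (Orb (FermionTorus 2 L))),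
      Tendsto Ls atTop atTop →
      (∀ j, IsGroundStateInSector (hubbardTorusTT' (Ls j) 1 t' U) (rectN n (Ls j)) 0 (ψ (Ls j))) →
      (∀ j, star (ψ (Ls j)) ⬝ᵥ ψ (Ls j) = 1) → ω.IsTorusLimitOf ψ Ls →
      (ω.expect ({0} : Finset (Site 2))
        (nAt 0 (Finset.mem_singleton_self 0) 0 * nAt 0 (Finset.mem_singleton_self 0) 1)).re < (n / 2) ^ 2 := by
  have hn0 : (0 : ℝ) ≤ n := by linarith
  have hn2' : n < 2 := by linarith
  have hnpos : (0 : ℝ) < n := by linarith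
  -- the class constant `(n/2)²` above its tangent at `n = 39/50`, scaled by the threshold `U₁ = 32/5`
  have hsq : (-1521 / 10000 : ℝ) + 39 / 100 * n ≤ (n / 2) ^ 2 := by nlinarith [sq_nonneg (n - 39 / 50)]
  have hsqU : ((-1521 / 10000 : ℝ) + 39 / 100 * n) * (32 / 5) ≤ (n / 2) ^ 2 * (32 / 5) :=
    mul_le_mul_of_nonneg_right hsq (by norm_num)
  have hR := objE_conc78_cap8 h445 h473 (s := t') ht2
  have hBs : (0 : ℝ) ≤ -0.6023622600 * t' := mul_nonneg_of_nonpos_of_nonpos (by norm_num) (by linarith)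
  have hcap := objE_lowBand_cap8 hR hBs hnpos hn2 (by norm_num)
  have ra := fermiSeaTangentRow_tPrime_neg_two_div_five_at_twentyone_div_twentyfive (U := 0) le_rfl hn0 hn2'
  have rb := fermiSeaTangentRow_tPrime_neg_three_div_ten_at_thirtynine_div_fifty (U := 0) le_rfl hn0 hn2'
  have rc := fermiSeaTangentRow_tPrime_neg_one_div_four_at_thirtynine_div_fifty (U := 0) le_rfl hn0 hn2'
  rcases le_or_gt t' (-3 / 10) with hp | hp
  · -- piece `t' ∈ [-2/5, -3/10]`: columns `-2/5` (touch 21/25), `-3/10` (touch 39/50)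
    have hfl := objE_floor_between hn0 hn2' (by norm_num : (-2 / 5 : ℝ) ≤ -3 / 10) ra rb ht1 hp
    exact doccN_lt_of_cap8_threshold (U₁ := 32 / 5) (by norm_num) (by norm_num) hU hn0 hn2' hcap hfl
      (sub_min_lt_of (by linarith) (by linarith))
  · -- piece `t' ∈ (-3/10, -1/4]`: columns `-3/10`, `-1/4` (touch 39/50)
    have hfl := objE_floor_between hn0 hn2' (by norm_num : (-3 / 10 : ℝ) ≤ -1 / 4) rb rc hp.le ht2
    exact doccN_lt_of_cap8_threshold (U₁ := 32 / 5) (by norm_num) (by norm_num) hU hn0 hn2' hcap hfl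
      (sub_min_lt_of (by linarith) (by linarith))

/-- **Nd₀.₉Sr₀.₁NiO₂ (VSET-v2 M59), OBJECT E `[5.0, 8.5] × [−0.46, −0.36] × [0.79, 0.89]` — MF/BCS class excluded on the sub-box `U ≥ 67/10`.**
Assume the claim nodes of CERTIFIED #445, #473, #472. For every `t′ ∈ [−23/50, −9/25]`, EVERY `U ≥ 6.7` and `n ∈ [79/100, 89/100]`, every GS torus limit has
`Re ω(n_{0↑}n_{0↓}) < (n/2)²`. Cap at `U = 8` = the `t′`-chord cap at `n = 7/8` (#445 ∧ #473), then the vacuum chord (`n ≤ 7/8`) / the density chord to the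
half-filling cap #472 (`n > 7/8`); floor = tangent rows at `21/25` (below `7/8`) / `7/8` (above) on the columns `−1/2, −2/5, −3/10`; smallest margin `+0.033`.
The strip `[5.0, 6.7)` of the box carries no word. [cite: KomaTasaki1994, §1] [cite: BachLiebSolovej1994, eq. (2c.36)] [cite: LiebLoss1993, §8, Theorem 8.2] -/
theorem ndE_x010_docc_lt_of (h445 : cert_dbt329pair_allk)
    (h473 : cert_r473_bs_M3U8tp0_w3_b4_R2_ob5p2_kry1_kry2c3rel_hanK7B4D4_KN4_PR20d4_hanK8c2s_hanK8B4D4_uprime)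
    (h472 : cert_r472_pb2_tl_upper_n1_U8)
    {t' U n : ℝ} (ht1 : -23 / 50 ≤ t') (ht2 : t' ≤ -9 / 25) (hU : 67 / 10 ≤ U)
    (hn1 : 79 / 100 ≤ n) (hn2 : n ≤ 89 / 100) :
    ∀ (ω : InfVolFermionState 2) (Ls : ℕ → ℕ) (ψ : ∀ L, Fock (Orb (FermionTorus 2 L))),
      Tendsto Ls atTop atTop →
      (∀ j, IsGroundStateInSector (hubbardTorusTT' (Ls j) 1 t' U) (rectN n (Ls j)) 0 (ψ (Ls j))) →
      (∀ j, star (ψ (Ls j)) ⬝ᵥ ψ (Ls j) = 1) → ω.IsTorusLimitOf ψ Ls →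
      (ω.expect ({0} : Finset (Site 2))
        (nAt 0 (Finset.mem_singleton_self 0) 0 * nAt 0 (Finset.mem_singleton_self 0) 1)).re < (n / 2) ^ 2 := by
  have hn0 : (0 : ℝ) ≤ n := by linarith
  have hn2' : n < 2 := by linarith
  have hnpos : (0 : ℝ) < n := by linarith
  -- the class constant `(n/2)²` above its tangent at `n = 79/100`, scaled by the threshold `U₁ = 67/10`
  have hsq : (-6241 / 40000 : ℝ) + 79 / 200 * n ≤ (n / 2) ^ 2 := by nlinarith [sq_nonneg (n - 79 / 100)]
  have hsqU : ((-6241 / 40000 : ℝ) + 79 / 200 * n) * (67 / 10) ≤ (n / 2) ^ 2 * (67 / 10) :=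
    mul_le_mul_of_nonneg_right hsq (by norm_num)
  have hC8 := objE_halfFilling_cap8 h472 t'
  have hR := objE_conc78_cap8 h445 h473 (s := t') (by linarith)
  have hBs : (0 : ℝ) ≤ -0.6023622600 * t' := mul_nonneg_of_nonpos_of_nonpos (by norm_num) (by linarith)
  -- floors: touch `21/25` for the lower band, touch `7/8` for the upper band
  have ra := fermiSeaTangentRow_tPrime_neg_one_div_two_at_twentyone_div_twentyfive (U := 0) le_rfl hn0 hn2'
  have rb := fermiSeaTangentRow_tPrime_neg_two_div_five_at_twentyone_div_twentyfive (U := 0) le_rfl hn0 hn2'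
  have rc := fermiSeaTangentRow_tPrime_neg_three_div_ten_at_twentyone_div_twentyfive (U := 0) le_rfl hn0 hn2'
  have sa := fermiSeaTangentRow_tPrime_neg_one_div_two_at_seven_div_eight (U := 0) le_rfl hn0 hn2'
  have sb := fermiSeaTangentRow_tPrime_neg_two_div_five_at_seven_div_eight (U := 0) le_rfl hn0 hn2'
  have sc := fermiSeaTangentRow_tPrime_neg_three_div_ten_at_seven_div_eight (U := 0) le_rfl hn0 hn2'
  rcases le_or_gt t' (-2 / 5) with hp | hp
  · -- piece `t' ∈ [-23/50, -2/5]`: columns `-1/2`, `-2/5`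
    rcases le_or_gt n (7 / 8) with hb | hb
    · have hfl := objE_floor_between hn0 hn2' (by norm_num : (-1 / 2 : ℝ) ≤ -2 / 5) ra rb (by linarith) hp
      have hcap := objE_lowBand_cap8 hR hBs hnpos hb le_rfl
      exact doccN_lt_of_cap8_threshold (U₁ := 67 / 10) (by norm_num) (by norm_num) hU hn0 hn2' hcap hfl
        (sub_min_lt_of (by linarith) (by linarith))
    · have hfl := objE_floor_between hn0 hn2' (by norm_num : (-1 / 2 : ℝ) ≤ -2 / 5) sa sb (by linarith) hp
      have hcap := objE_highBand_cap8 hR hC8 hBs (m := 7 / 8) hb.le hb (by linarith)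
      exact doccN_lt_of_cap8_threshold (U₁ := 67 / 10) (by norm_num) (by norm_num) hU hn0 hn2' hcap hfl
        (sub_min_lt_of (by linarith) (by linarith))
  · -- piece `t' ∈ (-2/5, -9/25]`: columns `-2/5`, `-3/10`
    rcases le_or_gt n (7 / 8) with hb | hb
    · have hfl := objE_floor_between hn0 hn2' (by norm_num : (-2 / 5 : ℝ) ≤ -3 / 10) rb rc hp.le (by linarith)
      have hcap := objE_lowBand_cap8 hR hBs hnpos hb le_rfl
      exact doccN_lt_of_cap8_threshold (U₁ := 67 / 10) (by norm_num) (by norm_num) hU hn0 hn2' hcap hfl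
        (sub_min_lt_of (by linarith) (by linarith))
    · have hfl := objE_floor_between hn0 hn2' (by norm_num : (-2 / 5 : ℝ) ≤ -3 / 10) sb sc hp.le (by linarith)
      have hcap := objE_highBand_cap8 hR hC8 hBs (m := 7 / 8) hb.le hb (by linarith)
      exact doccN_lt_of_cap8_threshold (U₁ := 67 / 10) (by norm_num) (by norm_num) hU hn0 hn2' hcap hfl
        (sub_min_lt_of (by linarith) (by linarith))

end Summit.Ventures.CertifiedManyBodySolver.Observables

end
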